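import Literature.MathematicalPhysics.QuantumFieldTheory.Balaban1983to89.B6MemberOfCubeV1
import Literature.MathematicalPhysics.QuantumFieldTheory.Balaban1983to89.B6MemberTorusTDomainsV1
import HarnessLib

/-!
# [B6] Prop. 2.6, (2.89)–(2.90): THE LEVELS OF THE MEMBER FAMILY `famOf … Λ′(□)` OF A CUBE AGREE WITH THE GLOBAL LEVELS THROUGH THE WINDOW —
the hypotheses `hsat`, `hlevW` (and `hal`) of the line-3 member inputs (`B6GluedLegsWindow.member_line3_inputs`, `B6ScalarAgreeV1Chart`) for
r03's members `B6MemberOfCubeV1.tOf` / `B6CubeWindowV1.tC`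

statement-level skeleton of published theorems with citation tags; proofs where landed; nothing here is a claim about the Yang–Mills mass gap

[tag: formalized_from_source] (construction ours; print (2.89) p.239 *"B^j(Λ) = □̃² ∩ B^{j+1}(Λ_{j+1})"*, p.238 *"We take the cube □̃³ and
identify it with a torus"* [cite: Balaban1984PropagatorsII, (2.89)–(2.90) p.239, p.238].)

## What

For r03's member `t = tOf hN D hk wG c′ mt Kt j hj ha x₀` of a window with corner `x₀` (`Λ′(□) = e_{j+1}(Ω_{j+1} ∩ window)`, `LamOf`) and the p21
presentation `D₁ := famOf Mh₁ j P₁ R₁ hj₁ t.Λ′` of `B6MemberTorusTDomainsV1` (levels `j + 1` on `B^j(Λ′)`, `j` elsewhere), under the ALIGNMENT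
`M_{h,1}L^{j+2} ∣ x₀` and `M_{h,1} ∣ M_h` (r03: `M_{h,1} = M_h/L`, `x₀ ∈ S_j·ℤ`):
* `deepS_of_iterBlockOf_eq_zero` — the window is a union of `(j+1)`-blocks: the whole block of a window site is in the window;
* `bigLab_eSj_eq_iff` — two window `(j+1)`-blocks have the same member big block iff they lie in the same global cube of side `M_{h,1}L^{j+2}`;
* **`lam_tOf_sat`** (`hsat`): `Λ′(□)` is a union of member big blocks;
* **`lev_famOf_tOf`** (`hlevW`): for `x` in the window, `lev_{D₁}(toBox (e x)) = lev_D(toBox x)` — given the two-level window `hlev`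
  (`B6CubeWindowV1.hlev_deep`).

No measure, no Yang–Mills claim.
-/

open scoped BigOperators
open Finset

namespace Literature.MathematicalPhysics.QuantumFieldTheory.Balaban1983to89.B6MemberLevelsWindow

open B4Reflection242 (boxDom blk mem_boxDom blk_mem_boxDom)
open B6MultiLevelBoxOperator (N0 bigSide)
open B6MultiLevelTorusOperator (TDomains)
open B6Prop25TwoScaleCensus (TSIdx)
open B6GlobalChartV1 (PV toBox toBox_apply domT iterBlockOf_mem_domT_iff blk_toBox)
open B5Eq118OneStroke (iterBlockOf iterBlock mem_iterBlock val_iterBlockOf)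
open B6AgreeLapV1Chart (eS DeepS deepS_mono)
open B6AgreeQaQV1Chart (eSj iterBlockOf_eS val_eSj iterBlockOf_window window_of_deep_block sitesPerDir_zero_eq_mul iterBlock_nonempty)
open B6MemberOfCubeV1 (tOf memberOf LamOf lam_memberOf eSj_surj)
open B6MemberTorusTDomainsV1 (famOf twoLevelT twoLevelT_lev lev_eq_or bigLab blk_bigSide_toBox)
open B6Geom246MultiLevelBox (bset)
open B6LowerBound2153Torus (rep)

variable {d ℓ : ℕ} {m K : ℕ} {hd : 1 ≤ d + 1} {hL : Odd (ℓ + 1) ∧ 1 < ℓ + 1} {a₀ a₁ : ℝ} {Mh k R : ℕ} {P' : Fin (d + 1) → ℕ}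
variable (hN : ∀ μ, N0 ℓ Mh k P' μ = (PV d ℓ m K hd hL).sitesPerDir 0) (D : TDomains d ℓ Mh k P' R) (hk : k ≤ m + K)

/-! ## §1  Window arithmetic: aligned blocks of window sites stay in the window; member big labels through the level chart -/

section Arith

omit hN D hk in
/-- nested block labels: `⌊⌊z/a⌋/b⌋ = ⌊z/(ab)⌋`. [folklore] -/
private theorem blk_blk (a b : ℕ) (z : Fin (d + 1) → ℤ) : blk b (blk a z) = blk (a * b) z := by
  funext μ
  simp only [blk]
  push_cast
  exact Int.ediv_ediv_of_nonneg (Int.natCast_nonneg a)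

omit hN D hk in
/-- **THE WINDOW IS A UNION OF `n`-BLOCKS** (`L^n ∣ x₀`, `n ≤ m_□ + K_□`): every site of the `n`-block of a window site is a window site.
[cite: Balaban1984PropagatorsII, p.238 («a sum of … big blocks»), dictionary] -/
theorem deepS_of_iterBlockOf_eq_zero {t : TSIdx d (ℓ + 1) hd hL a₀ a₁} {x₀ : Fin (d + 1) → ℤ} {n : ℕ} (hn : n ≤ m + K) (hnt : n ≤ t.m + t.K)
    (hdiv : ∀ μ, ((((ℓ + 1) ^ n : ℕ) : ℤ)) ∣ x₀ μ) {x x' : Site (PV d ℓ m K hd hL) 0} (hx : x ∈ DeepS t x₀ 0)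
    (h : iterBlockOf n x' = iterBlockOf n x) : x' ∈ DeepS t x₀ 0 := by
  intro μ
  have hLpos : (0 : ℤ) < (((ℓ + 1) ^ n : ℕ) : ℤ) := by positivity
  obtain ⟨a, ha⟩ := hdiv μ
  obtain ⟨h1, h2⟩ := hx μ
  simp only [Nat.cast_zero, add_zero] at h1 h2 ⊢
  have hN : ((t.P.sitesPerDir 0 : ℕ) : ℤ) = (((ℓ + 1) ^ n : ℕ) : ℤ) * (t.P.sitesPerDir n : ℕ) := by
    rw [sitesPerDir_zero_eq_mul t.P hnt]; push_cast; ring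
  have e : ((x' μ).val : ℤ) / (((ℓ + 1) ^ n : ℕ) : ℤ) = ((x μ).val : ℤ) / (((ℓ + 1) ^ n : ℕ) : ℤ) := by
    have h1' := val_iterBlockOf (P := PV d ℓ m K hd hL) n hn x' μ
    have h2' := val_iterBlockOf (P := PV d ℓ m K hd hL) n hn x μ
    rw [h] at h1'
    have : (x' μ).val / (ℓ + 1) ^ n = (x μ).val / (ℓ + 1) ^ n := h1'.symm.trans h2'
    have := congrArg (fun z : ℕ => (z : ℤ)) this
    push_cast at this
    exact this
  set q : ℤ := ((x μ).val : ℤ) / (((ℓ + 1) ^ n : ℕ) : ℤ) with hq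
  -- `a ≤ q < a + N′`
  rw [ha] at h1 h2
  rw [hN] at h2
  have hq1 : a ≤ q := by rw [hq]; exact Int.le_ediv_of_mul_le hLpos (by linarith)
  have hq2 : q < a + (t.P.sitesPerDir n : ℕ) := by rw [hq]; exact Int.ediv_lt_of_lt_mul hLpos (by linarith)
  -- `qL^n ≤ val x′ < (q+1)L^n`
  have hx'1 : q * (((ℓ + 1) ^ n : ℕ) : ℤ) ≤ ((x' μ).val : ℤ) := by rw [← e]; exact Int.ediv_mul_le _ hLpos.ne'
  have hx'2 : ((x' μ).val : ℤ) < (q + 1) * (((ℓ + 1) ^ n : ℕ) : ℤ) := by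
    rw [← e]; exact Int.lt_ediv_add_one_mul_self _ hLpos
  rw [ha, hN]
  constructor <;> nlinarith

omit hN D hk in
/-- **THE MEMBER BIG LABEL OF A CHARTED WINDOW BLOCK**: for a window `n`-block `Y` and `(M′L)·L^n ∣ x₀`,
`bigLab M′ (e_n Y) = blk (M′L) (rep Y) − x₀/(M′L^{n+1})`. [cite: Balaban1984PropagatorsII, p.238, (2.89) p.239, dictionary] -/
theorem bigLab_eSj {t : TSIdx d (ℓ + 1) hd hL a₀ a₁} {x₀ : Fin (d + 1) → ℤ} {n : ℕ} {Mh₁ : ℕ} (hM1 : 1 ≤ Mh₁)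
    (hdivB : ∀ μ, ((((ℓ + 1) ^ n * (Mh₁ * (ℓ + 1)) : ℕ) : ℤ)) ∣ x₀ μ) {Y : Site (PV d ℓ m K hd hL) n}
    (hY : ∀ μ, x₀ μ / (((ℓ + 1) ^ n : ℕ) : ℤ) ≤ ((Y μ).val : ℤ) ∧ ((Y μ).val : ℤ) < x₀ μ / (((ℓ + 1) ^ n : ℕ) : ℤ) + (t.P.sitesPerDir n : ℕ))
    (μ : Fin (d + 1)) :
    bigLab Mh₁ (eSj t x₀ n Y) μ = blk (Mh₁ * (ℓ + 1)) (rep (B5Eq117TorusCarriers.Mk (PV d ℓ m K hd hL) n) Y) μ -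
      x₀ μ / ((((ℓ + 1) ^ n * (Mh₁ * (ℓ + 1)) : ℕ) : ℤ)) := by
  have hLpos : (0 : ℤ) < (((ℓ + 1) ^ n : ℕ) : ℤ) := by positivity
  have hMpos : (0 : ℤ) < ((Mh₁ * (ℓ + 1) : ℕ) : ℤ) := by
    have : 1 ≤ Mh₁ * (ℓ + 1) := Nat.one_le_iff_ne_zero.2 (Nat.mul_ne_zero (by omega) (by omega))
    exact_mod_cast this
  have hbig : ((((ℓ + 1) ^ n * (Mh₁ * (ℓ + 1)) : ℕ) : ℤ)) ≠ 0 := by positivity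
  obtain ⟨a, ha⟩ := hdivB μ
  have hx0 : x₀ μ / (((ℓ + 1) ^ n : ℕ) : ℤ) = ((Mh₁ * (ℓ + 1) : ℕ) : ℤ) * a := by
    rw [ha]
    have e : (((ℓ + 1) ^ n * (Mh₁ * (ℓ + 1)) : ℕ) : ℤ) * a = (((ℓ + 1) ^ n : ℕ) : ℤ) * ((((Mh₁ * (ℓ + 1)) : ℕ) : ℤ) * a) := by
      push_cast; ring
    rw [e, Int.mul_ediv_cancel_left _ hLpos.ne']
  show ((((eSj t x₀ n Y) μ).val : ℤ)) / ((Mh₁ * (ℓ + 1) : ℕ) : ℤ) = ((Y μ).val : ℤ) / ((Mh₁ * (ℓ + 1) : ℕ) : ℤ) - _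
  rw [val_eSj hY μ, hx0, ha, Int.mul_ediv_cancel_left _ hbig,
    show ((Y μ).val : ℤ) - ((Mh₁ * (ℓ + 1) : ℕ) : ℤ) * a = ((Y μ).val : ℤ) + (-a) * ((Mh₁ * (ℓ + 1) : ℕ) : ℤ) by ring,
    Int.add_mul_ediv_right _ _ hMpos.ne']
  ring

omit hN D hk in
/-- **SAME MEMBER BIG BLOCK ⟺ SAME GLOBAL CUBE OF SIDE `M′L^{n+1}`** for two charted window `n`-blocks.
[cite: Balaban1984PropagatorsII, p.238, (2.89) p.239, dictionary] -/
theorem bigLab_eSj_eq_iff {t : TSIdx d (ℓ + 1) hd hL a₀ a₁} {x₀ : Fin (d + 1) → ℤ} {n : ℕ} {Mh₁ : ℕ} (hM1 : 1 ≤ Mh₁)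
    (hdivB : ∀ μ, ((((ℓ + 1) ^ n * (Mh₁ * (ℓ + 1)) : ℕ) : ℤ)) ∣ x₀ μ) {Y Y' : Site (PV d ℓ m K hd hL) n}
    (hY : ∀ μ, x₀ μ / (((ℓ + 1) ^ n : ℕ) : ℤ) ≤ ((Y μ).val : ℤ) ∧ ((Y μ).val : ℤ) < x₀ μ / (((ℓ + 1) ^ n : ℕ) : ℤ) + (t.P.sitesPerDir n : ℕ))
    (hY' : ∀ μ, x₀ μ / (((ℓ + 1) ^ n : ℕ) : ℤ) ≤ ((Y' μ).val : ℤ) ∧ ((Y' μ).val : ℤ) < x₀ μ / (((ℓ + 1) ^ n : ℕ) : ℤ) + (t.P.sitesPerDir n : ℕ)) :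
    bigLab Mh₁ (eSj t x₀ n Y) = bigLab Mh₁ (eSj t x₀ n Y') ↔
      blk (Mh₁ * (ℓ + 1)) (rep (B5Eq117TorusCarriers.Mk (PV d ℓ m K hd hL) n) Y) =
        blk (Mh₁ * (ℓ + 1)) (rep (B5Eq117TorusCarriers.Mk (PV d ℓ m K hd hL) n) Y') := by
  constructor
  · intro h; funext μ
    have hμ := congrFun h μ
    rw [bigLab_eSj hM1 hdivB hY μ, bigLab_eSj hM1 hdivB hY' μ] at hμ
    linarith
  · intro h; funext μ
    have hμ := congrFun h μ
    rw [bigLab_eSj hM1 hdivB hY μ, bigLab_eSj hM1 hdivB hY' μ, hμ]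

omit D hk in
/-- the member big block of a charted block vs the global cube of side `M′L^{n+1}` of its fine sites.
[cite: Balaban1984PropagatorsII, p.238, dictionary] -/
theorem blk_cube_toBox (Mh₁ : ℕ) {n : ℕ} (hn : n ≤ m + K) (x : Site (PV d ℓ m K hd hL) 0) :
    blk ((ℓ + 1) ^ n * (Mh₁ * (ℓ + 1))) (toBox hN x : Fin (d + 1) → ℤ) =
      blk (Mh₁ * (ℓ + 1)) (rep (B5Eq117TorusCarriers.Mk (PV d ℓ m K hd hL) n) (iterBlockOf n x)) := by
  rw [← blk_blk, blk_toBox hN hn x]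

end Arith

/-! ## §2  `Λ′(□)` is big-block saturated; the member levels are the global levels -/

section Levels

variable (wG : B6SectAOperatorsV1.BondIdx (domT hN D hk) → ℝ) (c' : ℝ) (mt Kt j : ℕ) (hj : j + 1 ≤ mt + Kt) (ha : a₀ ≤ a₁)
  (x₀ : Fin (d + 1) → ℤ)

variable {hN D hk wG c' mt Kt j hj ha x₀}

/-- `L^{j+1} ∣ x₀` from the big alignment `M′L^{j+2} ∣ x₀`. [cite: Balaban1984PropagatorsII, p.238, bookkeeping] -/
theorem dvd_of_dvdB {Mh₁ : ℕ} (hdivB : ∀ μ, ((((ℓ + 1) ^ (j + 1) * (Mh₁ * (ℓ + 1)) : ℕ) : ℤ)) ∣ x₀ μ) (μ : Fin (d + 1)) :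
    ((((ℓ + 1) ^ (j + 1) : ℕ) : ℤ)) ∣ x₀ μ := by
  obtain ⟨a, ha'⟩ := hdivB μ
  exact ⟨((Mh₁ * (ℓ + 1) : ℕ) : ℤ) * a, by rw [ha']; push_cast; ring⟩

/-- same global `M′L^{j+2}`-cube ⇒ same global big `(j+1)`-block (`M′ ∣ M_h`), hence the same side of `Ω_{j+1}` ((2.1)).
[cite: Balaban1984PropagatorsII, (2.1) p.224, dictionary] -/
theorem succ_le_lev_iff_of_cube {Mh₁ : ℕ} (hMh : Mh₁ ∣ Mh) (hj1 : 1 ≤ j) {x x' : Site (PV d ℓ m K hd hL) 0}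
    (h : blk ((ℓ + 1) ^ (j + 1) * (Mh₁ * (ℓ + 1))) (toBox hN x : Fin (d + 1) → ℤ) =
      blk ((ℓ + 1) ^ (j + 1) * (Mh₁ * (ℓ + 1))) (toBox hN x' : Fin (d + 1) → ℤ)) :
    j + 1 ≤ D.lev (toBox hN x : Fin (d + 1) → ℤ) ↔ j + 1 ≤ D.lev (toBox hN x' : Fin (d + 1) → ℤ) := by
  obtain ⟨q, hq⟩ := hMh
  have e : bigSide ℓ Mh (j + 1) = ((ℓ + 1) ^ (j + 1) * (Mh₁ * (ℓ + 1))) * q := by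
    unfold bigSide; rw [hq]; ring
  have hb : blk (bigSide ℓ Mh (j + 1)) (toBox hN x' : Fin (d + 1) → ℤ) = blk (bigSide ℓ Mh (j + 1)) (toBox hN x : Fin (d + 1) → ℤ) := by
    rw [e, ← blk_blk ((ℓ + 1) ^ (j + 1) * (Mh₁ * (ℓ + 1))) q, ← blk_blk ((ℓ + 1) ^ (j + 1) * (Mh₁ * (ℓ + 1))) q, h]
  exact D.bigBlocks (j + 1) (by omega) _ (toBox hN x).2 _ (toBox hN x').2 hb

/-- **`Λ′(□)` IS BIG-BLOCK SATURATED** (`hsat` of `B6MemberTorusTDomainsV1` / `B6ScalarFactorsChartV1` for the member family `famOf … Λ′(□)`):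
two member `(j+1)`-sites with the same member big block are both in `Λ′(□)` or both out.
[cite: Balaban1984PropagatorsII, (2.89) p.239 («B^j(Λ) = □̃² ∩ B^{j+1}(Λ_{j+1})»), (2.1) p.224; derivation ours] -/
theorem lam_tOf_sat {Mh₁ : ℕ} (hjk : j + 1 ≤ k) (hx₀ : ∀ μ, 0 ≤ x₀ μ)
    (hfit : ∀ μ, x₀ μ + ((tOf hN D hk wG c' mt Kt j hj ha x₀).P.sitesPerDir 0 : ℕ) ≤ ((PV d ℓ m K hd hL).sitesPerDir 0 : ℕ))
    (hdivB : ∀ μ, ((((ℓ + 1) ^ (j + 1) * (Mh₁ * (ℓ + 1)) : ℕ) : ℤ)) ∣ x₀ μ) (hMh : Mh₁ ∣ Mh) (hM1 : 1 ≤ Mh₁) (hj1 : 1 ≤ j)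
    (Y Y' : Site (PV d ℓ mt Kt hd hL) (j + 1)) (h : bigLab Mh₁ Y = bigLab Mh₁ Y') :
    Y ∈ (tOf hN D hk wG c' mt Kt j hj ha x₀).Λ' ↔ Y' ∈ (tOf hN D hk wG c' mt Kt j hj ha x₀).Λ' := by
  classical
  have hjm : j + 1 ≤ m + K := hjk.trans hk
  have hjt : j + 1 ≤ (tOf hN D hk wG c' mt Kt j hj ha x₀).m + (tOf hN D hk wG c' mt Kt j hj ha x₀).K := hj
  have hdiv : ∀ μ, ((((ℓ + 1) ^ (j + 1) : ℕ) : ℤ)) ∣ x₀ μ := dvd_of_dvdB hdivB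
  -- both are charts of window blocks of window sites
  obtain ⟨x, hx, hxY⟩ := eSj_surj (t := tOf hN D hk wG c' mt Kt j hj ha x₀) hjm hjt hdiv hx₀ hfit Y
  obtain ⟨x', hx', hxY'⟩ := eSj_surj (t := tOf hN D hk wG c' mt Kt j hj ha x₀) hjm hjt hdiv hx₀ hfit Y'
  have hblk : ∀ z, iterBlockOf (j + 1) z = iterBlockOf (j + 1) x → z ∈ DeepS (tOf hN D hk wG c' mt Kt j hj ha x₀) x₀ 0 :=
    fun z hz => deepS_of_iterBlockOf_eq_zero hjm hjt hdiv hx hz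
  have hblk' : ∀ z, iterBlockOf (j + 1) z = iterBlockOf (j + 1) x' → z ∈ DeepS (tOf hN D hk wG c' mt Kt j hj ha x₀) x₀ 0 :=
    fun z hz => deepS_of_iterBlockOf_eq_zero hjm hjt hdiv hx' hz
  -- `Λ′` membership ↔ `Ω_{j+1}` membership of the global block ↔ `j + 1 ≤ lev`
  have hΛ : ∀ {z : Site (PV d ℓ m K hd hL) 0},
      (∀ z', iterBlockOf (j + 1) z' = iterBlockOf (j + 1) z → z' ∈ DeepS (tOf hN D hk wG c' mt Kt j hj ha x₀) x₀ 0) →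
      (eSj (tOf hN D hk wG c' mt Kt j hj ha x₀) x₀ (j + 1) (iterBlockOf (j + 1) z) ∈ (tOf hN D hk wG c' mt Kt j hj ha x₀).Λ' ↔
        j + 1 ≤ D.lev (toBox hN z : Fin (d + 1) → ℤ)) := by
    intro z hzb
    rw [← iterBlockOf_mem_domT_iff hN D hk (by omega) hjk z]
    exact lam_memberOf (mt := mt) (Kt := Kt) (j := j) (hj := hj) (ha := ha) (x₀ := x₀) hjm hdiv (iterBlockOf (j + 1) z) hzb
  -- the two global blocks lie in the same `M′L^{j+2}`-cube
  have hcube : blk ((ℓ + 1) ^ (j + 1) * (Mh₁ * (ℓ + 1))) (toBox hN x : Fin (d + 1) → ℤ) =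
      blk ((ℓ + 1) ^ (j + 1) * (Mh₁ * (ℓ + 1))) (toBox hN x' : Fin (d + 1) → ℤ) := by
    rw [blk_cube_toBox hN Mh₁ hjm x, blk_cube_toBox hN Mh₁ hjm x']
    rw [← hxY, ← hxY'] at h
    exact (bigLab_eSj_eq_iff (t := tOf hN D hk wG c' mt Kt j hj ha x₀) hM1 hdivB (iterBlockOf_window hjm hjt hdiv hx)
      (iterBlockOf_window hjm hjt hdiv hx')).1 h
  rw [← hxY, ← hxY']
  exact (hΛ hblk).trans ((succ_le_lev_iff_of_cube hMh hj1 hcube).trans (hΛ hblk').symm)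

/-- **THE MEMBER LEVELS ARE THE GLOBAL LEVELS THROUGH THE WINDOW** (`hlevW` of `B6ScalarAgreeV1Chart` / `B6GluedLegsWindow.member_line3_inputs`
for `D₁ := famOf M′ j P₁ R₁ hj₁ Λ′(□)`): for every window site `x`, `lev_{D₁}(toBox (e x)) = lev_D(toBox x)`, given the two-level window
`j ≤ lev_D ≤ j + 1` there (r03's `hlev_deep`). [cite: Balaban1984PropagatorsII, (2.89)–(2.90) p.239, p.238; derivation ours] -/
theorem lev_famOf_tOf {Mh₁ : ℕ} (hjk : j + 1 ≤ k) (hx₀ : ∀ μ, 0 ≤ x₀ μ)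
    (hfit : ∀ μ, x₀ μ + ((tOf hN D hk wG c' mt Kt j hj ha x₀).P.sitesPerDir 0 : ℕ) ≤ ((PV d ℓ m K hd hL).sitesPerDir 0 : ℕ))
    (hdivB : ∀ μ, ((((ℓ + 1) ^ (j + 1) * (Mh₁ * (ℓ + 1)) : ℕ) : ℤ)) ∣ x₀ μ) (hMh : Mh₁ ∣ Mh) (hM1 : 1 ≤ Mh₁) (hj1 : 1 ≤ j) {P₁ : Fin (d + 1) → ℕ} {R₁ : ℕ}
    (hN₁ : ∀ μ, N0 ℓ Mh₁ (j + 1) P₁ μ = (PV d ℓ mt Kt hd hL).sitesPerDir 0)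
    (hlev : ∀ x : Site (PV d ℓ m K hd hL) 0, x ∈ DeepS (tOf hN D hk wG c' mt Kt j hj ha x₀) x₀ 0 →
      j ≤ D.lev (toBox hN x : Fin (d + 1) → ℤ) ∧ D.lev (toBox hN x : Fin (d + 1) → ℤ) ≤ j + 1)
    {x : Site (PV d ℓ m K hd hL) 0} (hx : x ∈ DeepS (tOf hN D hk wG c' mt Kt j hj ha x₀) x₀ 0) :
    (famOf Mh₁ j P₁ R₁ hj1 (tOf hN D hk wG c' mt Kt j hj ha x₀).Λ').lev
        (toBox hN₁ (eS (tOf hN D hk wG c' mt Kt j hj ha x₀) x₀ x) : Fin (d + 1) → ℤ) =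
      D.lev (toBox hN x : Fin (d + 1) → ℤ) := by
  classical
  have hjm : j + 1 ≤ m + K := hjk.trans hk
  have hjt : j + 1 ≤ (tOf hN D hk wG c' mt Kt j hj ha x₀).m + (tOf hN D hk wG c' mt Kt j hj ha x₀).K := hj
  have hdiv : ∀ μ, ((((ℓ + 1) ^ (j + 1) : ℕ) : ℤ)) ∣ x₀ μ := dvd_of_dvdB hdivB
  have hblk : ∀ z, iterBlockOf (j + 1) z = iterBlockOf (j + 1) x → z ∈ DeepS (tOf hN D hk wG c' mt Kt j hj ha x₀) x₀ 0 :=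
    fun z hz => deepS_of_iterBlockOf_eq_zero hjm hjt hdiv hx hz
  show (B6MemberTorusTDomainsV1.twoLevelT ℓ Mh₁ j P₁ R₁ hj1 ((tOf hN D hk wG c' mt Kt j hj ha x₀).Λ'.image (bigLab Mh₁))).lev _ = _
  have eblk : (iterBlockOf (P := PV d ℓ mt Kt hd hL) (j + 1) (eS (tOf hN D hk wG c' mt Kt j hj ha x₀) x₀ x) : Site (PV d ℓ mt Kt hd hL) (j + 1)) =
      eSj (tOf hN D hk wG c' mt Kt j hj ha x₀) x₀ (j + 1) (iterBlockOf (j + 1) x) :=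
    iterBlockOf_eS hjm hjt hdiv hx
  rw [twoLevelT_lev, blk_bigSide_toBox hN₁ hjt, eblk]
  -- membership of the big label in `bigLab″Λ′` ↔ membership of the block in `Λ′` (saturation) ↔ `j + 1 ≤ lev`
  have hmemΛ : eSj (tOf hN D hk wG c' mt Kt j hj ha x₀) x₀ (j + 1) (iterBlockOf (j + 1) x) ∈ (tOf hN D hk wG c' mt Kt j hj ha x₀).Λ' ↔
      j + 1 ≤ D.lev (toBox hN x : Fin (d + 1) → ℤ) := by
    rw [← iterBlockOf_mem_domT_iff hN D hk (by omega) hjk x]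
    exact lam_memberOf (mt := mt) (Kt := Kt) (j := j) (hj := hj) (ha := ha) (x₀ := x₀) hjm hdiv (iterBlockOf (j + 1) x) hblk
  have key : bigLab Mh₁ (eSj (tOf hN D hk wG c' mt Kt j hj ha x₀) x₀ (j + 1) (iterBlockOf (j + 1) x)) ∈
      (tOf hN D hk wG c' mt Kt j hj ha x₀).Λ'.image (bigLab Mh₁) ↔ j + 1 ≤ D.lev (toBox hN x : Fin (d + 1) → ℤ) := by
    rw [Finset.mem_image, ← hmemΛ]
    constructor
    · rintro ⟨Y, hY, hlab⟩
      exact (lam_tOf_sat hjk hx₀ hfit hdivB hMh hM1 hj1 Y _ hlab).1 hY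
    · intro hl
      exact ⟨_, hl, rfl⟩
  obtain ⟨h1, h2⟩ := hlev x hx
  split_ifs with hc
  · have := key.1 hc; omega
  · have : ¬ j + 1 ≤ D.lev (toBox hN x : Fin (d + 1) → ℤ) := fun h => hc (key.2 h); omega

end Levels

/-! ## §3  The member block set is small: `|𝔅(T_□)| ≤ 2·Π_μ (M′L²P₁μ)` (uniform in `j`; polynomial in `M`) -/

section Card

omit hN D hk

/-- the box has `Π_μ N_μ` points. [folklore] -/
private theorem card_boxDom (N : Fin (d + 1) → ℕ) : (boxDom N).card = ∏ μ, N μ := by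
  unfold boxDom
  rw [Fintype.card_piFinset]
  refine Finset.prod_congr rfl fun μ _ => ?_
  rw [Int.card_Ico]; simp

/-- the level-`i` labels of the box `N = b·M` (coordinatewise) number at most `Π_μ M_μ`. [folklore] -/
private theorem card_image_blk_le {b : ℕ} (hb : 1 ≤ b) (M : Fin (d + 1) → ℕ) (i : ℕ) :
    ((boxDom (fun μ => b * M μ)).image fun x => (i, blk b x)).card ≤ ∏ μ, M μ := by
  classical
  rw [← card_boxDom M]
  refine Finset.card_le_card_of_injOn (fun p => p.2) (fun p hp => ?_) (fun p hp p' hp' h => ?_)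
  · obtain ⟨x, hx, rfl⟩ := Finset.mem_image.1 hp
    exact blk_mem_boxDom hb hx
  · obtain ⟨x, -, rfl⟩ := Finset.mem_image.1 (Finset.mem_coe.1 hp)
    obtain ⟨x', -, rfl⟩ := Finset.mem_image.1 (Finset.mem_coe.1 hp')
    simp only at h
    rw [h]

/-- **THE MEMBER TORUS HAS FEW BLOCKS**: the block set of the two-level family `famOf M′ j P₁ R₁ hj Λ′` (levels `j`, `j+1` on the box
`N₀ = M′L^{j+2}P₁`) has at most `2·Π_μ (M′·L²·P₁ μ)` elements — uniform in `j` and polynomial in `M` (the size entering the `d′`-profile constant of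
`B6GluedDistWindow.profileW`, to be absorbed into `e^{−cM}`). [cite: Balaban1984PropagatorsII, (2.45) p.231, p.238 (T_□); bookkeeping ours] -/
theorem card_bset_famOf_le {mt Kt j Mh₁ R₁ : ℕ} {P₁ : Fin (d + 1) → ℕ} (hj : 1 ≤ j) (Λ' : Finset (Site (PV d ℓ mt Kt hd hL) (j + 1))) :
    (bset (famOf Mh₁ j P₁ R₁ hj Λ').toDomains).card ≤ 2 * ∏ μ, (Mh₁ * (ℓ + 1) ^ 2 * P₁ μ) := by
  classical
  have hL1 : 1 ≤ ℓ + 1 := by omega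
  -- the box as `L^j · (M′L²P₁)` and as `L^{j+1} · (M′LP₁)`
  have eN : ∀ μ, N0 ℓ Mh₁ (j + 1) P₁ μ = (ℓ + 1) ^ j * (Mh₁ * (ℓ + 1) ^ 2 * P₁ μ) := by
    intro μ; unfold N0; ring
  have eN' : ∀ μ, N0 ℓ Mh₁ (j + 1) P₁ μ = (ℓ + 1) ^ (j + 1) * (Mh₁ * (ℓ + 1) * P₁ μ) := by
    intro μ; unfold N0; ring
  have hsub : bset (famOf Mh₁ j P₁ R₁ hj Λ').toDomains ⊆
      ((boxDom fun μ => (ℓ + 1) ^ j * (Mh₁ * (ℓ + 1) ^ 2 * P₁ μ)).image fun x => (j, blk ((ℓ + 1) ^ j) x)) ∪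
        ((boxDom fun μ => (ℓ + 1) ^ (j + 1) * (Mh₁ * (ℓ + 1) * P₁ μ)).image fun x => (j + 1, blk ((ℓ + 1) ^ (j + 1)) x)) := by
    intro p hp
    unfold bset at hp
    obtain ⟨x, hx, rfl⟩ := Finset.mem_image.1 hp
    have hx1 : x ∈ boxDom fun μ => (ℓ + 1) ^ j * (Mh₁ * (ℓ + 1) ^ 2 * P₁ μ) := by
      have e : (fun μ => (ℓ + 1) ^ j * (Mh₁ * (ℓ + 1) ^ 2 * P₁ μ)) = N0 ℓ Mh₁ (j + 1) P₁ := funext fun μ => (eN μ).symm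
      rw [e]; exact hx
    have hx2 : x ∈ boxDom fun μ => (ℓ + 1) ^ (j + 1) * (Mh₁ * (ℓ + 1) * P₁ μ) := by
      have e : (fun μ => (ℓ + 1) ^ (j + 1) * (Mh₁ * (ℓ + 1) * P₁ μ)) = N0 ℓ Mh₁ (j + 1) P₁ := funext fun μ => (eN' μ).symm
      rw [e]; exact hx
    show ((famOf Mh₁ j P₁ R₁ hj Λ').toDomains.lev x, blk ((ℓ + 1) ^ (famOf Mh₁ j P₁ R₁ hj Λ').toDomains.lev x) x) ∈ _
    rw [TDomains.toDomains_lev]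
    rcases lev_eq_or (P := P₁) (R := R₁) (ℓ := ℓ) (Mh := Mh₁) hj (Λ'.image (bigLab Mh₁)) x with h | h
    · rw [show (famOf Mh₁ j P₁ R₁ hj Λ').lev x = j from h]
      exact Finset.mem_union_left _ (Finset.mem_image_of_mem _ hx1)
    · rw [show (famOf Mh₁ j P₁ R₁ hj Λ').lev x = j + 1 from h]
      exact Finset.mem_union_right _ (Finset.mem_image_of_mem _ hx2)
  refine (Finset.card_le_card hsub).trans ((Finset.card_union_le _ _).trans ?_)
  have h1 := card_image_blk_le (d := d) (Nat.one_le_pow _ _ hL1 : 1 ≤ (ℓ + 1) ^ j) (fun μ => Mh₁ * (ℓ + 1) ^ 2 * P₁ μ) j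
  have h2 := card_image_blk_le (d := d) (Nat.one_le_pow _ _ hL1 : 1 ≤ (ℓ + 1) ^ (j + 1)) (fun μ => Mh₁ * (ℓ + 1) * P₁ μ) (j + 1)
  have h3 : ∏ μ, (Mh₁ * (ℓ + 1) * P₁ μ) ≤ ∏ μ, (Mh₁ * (ℓ + 1) ^ 2 * P₁ μ) :=
    Finset.prod_le_prod' fun μ _ => Nat.mul_le_mul_right _ (Nat.mul_le_mul_left _ (by nlinarith))
  omega

end Card

end Literature.MathematicalPhysics.QuantumFieldTheory.Balaban1983to89.B6MemberLevelsWindow
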